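import Mathlib
import Summits.Ventures.PercRepro2.ZMeanProof
import Summits.Ventures.PercRepro2.PendantRoot
import Summits.Ventures.PercRepro2.PocketTransport
import Summits.Ventures.PercRepro2.StarGlue
import Summits.Ventures.PercRepro2.StarOEvents
import Summits.Ventures.PercRepro2.StarOProb

/-!
# The three-coin star at `a₃` (class O): the PD-masses (blind cell PercRepro2, night-1 g8; NIGHT1-G8.md §4)

`D = P(PD)`, `P(PD, o ∈ C₁)`, `P(PD, o ∈ C₂)`, `M₂ = P(PD, b ∈ C₂)` over the eight coin outcomes:
`PD` lives on the outcomes with both root coins closed; with the `o`-coin closed `a₃` is isolated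
and `PD = Q₁`; with the `o`-coin open `a₃ ∈ U` iff `o ∈ U`.
-/

namespace Summit.Ventures.PercRepro2

open StarGlue PendantRoot UnionCluster

namespace StarO

section MassPD

variable {V : Type*} {E : Type*} [Fintype E] [DecidableEq E] [Fintype V] [DecidableEq V]
  {R : Type*} [Field R] [LinearOrder R] [IsStrictOrderedRing R]

variable (p : E → R) (ends : E → Sym2 V) {f₁ f₂ f₃ : E} {a₃ a₁ a₂ o : V}

omit [Fintype E] [DecidableEq E] [Fintype V] [DecidableEq V] in
/-- Membership in `PD`. -/
lemma mem_PD {ω : Config E} :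
    ω ∈ PDEvent ends a₁ a₂ a₃ ↔ ¬ Conn ends ω a₁ a₂ ∧ ¬ Conn ends ω a₃ a₁ ∧ ¬ Conn ends ω a₃ a₂ := by
  simp only [PDEvent, Dtilde, inU, Set.mem_inter_iff, Set.mem_compl_iff, mem_connEvent,
    Set.mem_union, not_or]

omit [Fintype E] [DecidableEq E] [Fintype V] [DecidableEq V] in
/-- `PD ∩ X ∩ outc` with a root coin open is empty. -/
lemma PD_inter_outc_root (hf₁ : ends f₁ = s(a₃, a₁)) (hf₂ : ends f₂ = s(a₃, a₂))
    (X : Set (Config E)) {b₁ b₂ b₃ : Bool} (hb : b₁ = true ∨ b₂ = true) :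
    PDEvent ends a₁ a₂ a₃ ∩ X ∩ outc f₁ f₂ f₃ b₁ b₂ b₃ = ∅ := by
  ext ω
  simp only [Set.mem_inter_iff, mem_PD, mem_outc, Set.mem_empty_iff_false, iff_false, not_and]
  rintro ⟨⟨_, h31, h32⟩, _⟩ h1 h2 _
  rcases hb with rfl | rfl
  · exact h31 (conn_of_openAdj ⟨f₁, h1, hf₁⟩)
  · exact h32 (conn_of_openAdj ⟨f₂, h2, hf₂⟩)

omit [Fintype E] [DecidableEq E] in
/-- `PD ∩ viaStar X ∩ outc` with every coin closed: `a₃` isolated, `PD = Q₁`. -/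
lemma PD_inter_outc_ccc (hf₁ : ends f₁ = s(a₃, a₁)) (hf₂ : ends f₂ = s(a₃, a₂))
    (hf₃ : ends f₃ = s(a₃, o)) (hstar : ∀ e, a₃ ∈ ends e → e = f₁ ∨ e = f₂ ∨ e = f₃)
    (h31 : a₃ ≠ a₁) (h32 : a₃ ≠ a₂) (h3o : a₃ ≠ o) (X : Set (Config E)) :
    PDEvent ends a₁ a₂ a₃ ∩ viaStar ends a₃ X ∩ outc f₁ f₂ f₃ false false false =
      viaStar ends a₃ (avoidAll ends a₂ {a₁} ∩ X) ∩ outc f₁ f₂ f₃ false false false := by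
  ext ω
  simp only [Set.mem_inter_iff, mem_PD, mem_outc, viaStar, Set.mem_setOf_eq, avoidAll_eq_compl,
    Set.mem_compl_iff, mem_connEvent]
  constructor
  · rintro ⟨⟨⟨hQ, _, _⟩, hX⟩, h1, h2, h3⟩
    refine ⟨⟨fun h => hQ ?_, hX⟩, h1, h2, h3⟩
    rw [conn_iff_single hf₁ hf₂ hf₃ hstar h31 h32 h3o (by simp [h1]) (by simp [h1]) (by simp [h2])
      h31.symm h32.symm]
    exact h
  · rintro ⟨⟨hQ, hX⟩, h1, h2, h3⟩
    refine ⟨⟨⟨fun h => hQ ?_, not_conn_a3_ccc hf₁ hf₂ hf₃ hstar h31 h32 h3o h1 h2 h3 h31.symm,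
      not_conn_a3_ccc hf₁ hf₂ hf₃ hstar h31 h32 h3o h1 h2 h3 h32.symm⟩, hX⟩, h1, h2, h3⟩
    rw [conn_iff_single hf₁ hf₂ hf₃ hstar h31 h32 h3o (by simp [h1]) (by simp [h1]) (by simp [h2])
      h31.symm h32.symm] at h
    exact h

omit [Fintype E] [DecidableEq E] in
/-- `PD ∩ viaStar X ∩ outc` with only the `o`-coin open: `a₃ ∈ U` iff `o ∈ U`. -/
lemma PD_inter_outc_o (hf₁ : ends f₁ = s(a₃, a₁)) (hf₂ : ends f₂ = s(a₃, a₂))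
    (hf₃ : ends f₃ = s(a₃, o)) (hstar : ∀ e, a₃ ∈ ends e → e = f₁ ∨ e = f₂ ∨ e = f₃)
    (h31 : a₃ ≠ a₁) (h32 : a₃ ≠ a₂) (h3o : a₃ ≠ o) (X : Set (Config E)) :
    PDEvent ends a₁ a₂ a₃ ∩ viaStar ends a₃ X ∩ outc f₁ f₂ f₃ false false true =
      viaStar ends a₃ (avoidAll ends a₂ {a₁} ∩ (connEvent ends o a₁)ᶜ ∩ (connEvent ends o a₂)ᶜ ∩ X) ∩
        outc f₁ f₂ f₃ false false true := by
  ext ω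
  simp only [Set.mem_inter_iff, mem_PD, mem_outc, viaStar, Set.mem_setOf_eq, avoidAll_eq_compl,
    Set.mem_compl_iff, mem_connEvent]
  have hs : ∀ {x y : V}, x ≠ a₃ → y ≠ a₃ → ω f₁ = false → ω f₂ = false → ω f₃ = true →
      (Conn ends ω x y ↔ Conn ends (closeStar ends a₃ ω) x y) := fun hx hy h1 h2 _ =>
    conn_iff_single hf₁ hf₂ hf₃ hstar h31 h32 h3o (by simp [h1]) (by simp [h1]) (by simp [h2]) hx hy
  constructor
  · rintro ⟨⟨⟨hQ, h31', h32'⟩, hX⟩, h1, h2, h3⟩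
    rw [conn_a3_iff_o_of_f3 hf₃ h3, hs h3o.symm h31.symm h1 h2 h3] at h31'
    rw [conn_a3_iff_o_of_f3 hf₃ h3, hs h3o.symm h32.symm h1 h2 h3] at h32'
    rw [hs h31.symm h32.symm h1 h2 h3] at hQ
    exact ⟨⟨⟨⟨hQ, h31'⟩, h32'⟩, hX⟩, h1, h2, h3⟩
  · rintro ⟨⟨⟨⟨hQ, h31'⟩, h32'⟩, hX⟩, h1, h2, h3⟩
    refine ⟨⟨⟨?_, ?_, ?_⟩, hX⟩, h1, h2, h3⟩
    · rw [hs h31.symm h32.symm h1 h2 h3]; exact hQ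
    · rw [conn_a3_iff_o_of_f3 hf₃ h3, hs h3o.symm h31.symm h1 h2 h3]; exact h31'
    · rw [conn_a3_iff_o_of_f3 hf₃ h3, hs h3o.symm h32.symm h1 h2 h3]; exact h32'

omit [LinearOrder R] [IsStrictOrderedRing R] in
/-- The factorised form of a `PD`-mass: `P(PD ∩ viaStar X) = ᾱβ̄ [r̄ P₀(Q ∩ X) + r P₀(Q ∩ oN ∩ X)]`. -/
theorem prob_PD_inter_star (hf₁ : ends f₁ = s(a₃, a₁)) (hf₂ : ends f₂ = s(a₃, a₂))
    (hf₃ : ends f₃ = s(a₃, o)) (hstar : ∀ e, a₃ ∈ ends e → e = f₁ ∨ e = f₂ ∨ e = f₃)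
    (h31 : a₃ ≠ a₁) (h32 : a₃ ≠ a₂) (h3o : a₃ ≠ o) (h12 : f₁ ≠ f₂) (h13 : f₁ ≠ f₃) (h23 : f₂ ≠ f₃)
    (X : Set (Config E)) :
    prob p (PDEvent ends a₁ a₂ a₃ ∩ viaStar ends a₃ X) =
      (1 - p f₁) * (1 - p f₂) *
        ((1 - p f₃) * prob (pOut p ends a₃) (avoidAll ends a₂ {a₁} ∩ X) +
          p f₃ * prob (pOut p ends a₃)
            (avoidAll ends a₂ {a₁} ∩ (connEvent ends o a₁)ᶜ ∩ (connEvent ends o a₂)ᶜ ∩ X)) := by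
  have hf1 : a₃ ∈ ends f₁ := by rw [hf₁]; exact Sym2.mem_mk_left _ _
  have hf2 : a₃ ∈ ends f₂ := by rw [hf₂]; exact Sym2.mem_mk_left _ _
  have hf3 : a₃ ∈ ends f₃ := by rw [hf₃]; exact Sym2.mem_mk_left _ _
  have fac : ∀ (A : Set (Config E)) (b₁ b₂ b₃ : Bool),
      prob p (viaStar ends a₃ A ∩ outc f₁ f₂ f₃ b₁ b₂ b₃) =
        prob (pOut p ends a₃) A * cw b₁ (p f₁) * cw b₂ (p f₂) * cw b₃ (p f₃) := by
    intro A b₁ b₂ b₃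
    rw [prob_inter_outc p h12 h13 h23 (free_viaStar ends a₃ hf1 A) (free_viaStar ends a₃ hf2 A)
      (free_viaStar ends a₃ hf3 A), prob_viaStar]
  rw [prob_eq_sum_outc p f₁ f₂ f₃]
  simp only [Fintype.sum_bool]
  rw [PD_inter_outc_root ends hf₁ hf₂ (viaStar ends a₃ X) (b₁ := true) (b₂ := true) (b₃ := true)
      (Or.inl rfl),
    PD_inter_outc_root ends hf₁ hf₂ (viaStar ends a₃ X) (b₁ := true) (b₂ := true) (b₃ := false)
      (Or.inl rfl),
    PD_inter_outc_root ends hf₁ hf₂ (viaStar ends a₃ X) (b₁ := true) (b₂ := false) (b₃ := true)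
      (Or.inl rfl),
    PD_inter_outc_root ends hf₁ hf₂ (viaStar ends a₃ X) (b₁ := true) (b₂ := false) (b₃ := false)
      (Or.inl rfl),
    PD_inter_outc_root ends hf₁ hf₂ (viaStar ends a₃ X) (b₁ := false) (b₂ := true) (b₃ := true)
      (Or.inr rfl),
    PD_inter_outc_root ends hf₁ hf₂ (viaStar ends a₃ X) (b₁ := false) (b₂ := true) (b₃ := false)
      (Or.inr rfl),
    PD_inter_outc_o ends hf₁ hf₂ hf₃ hstar h31 h32 h3o X,
    PD_inter_outc_ccc ends hf₁ hf₂ hf₃ hstar h31 h32 h3o X, fac, fac, prob_empty]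
  simp only [cw, ↓reduceIte, Bool.false_eq_true]
  ring

omit [Fintype E] [DecidableEq E] [Fintype V] [DecidableEq V] in
/-- On `PD` both root coins are closed. -/
lemma root_coins_closed_of_mem_PD (hf₁ : ends f₁ = s(a₃, a₁)) (hf₂ : ends f₂ = s(a₃, a₂))
    {ω : Config E} (h : ω ∈ PDEvent ends a₁ a₂ a₃) : ω f₁ = false ∧ ω f₂ = false := by
  rw [mem_PD] at h
  constructor
  · cases h1 : ω f₁
    · rfl
    · exact absurd (conn_of_openAdj ⟨f₁, h1, hf₁⟩) h.2.1
  · cases h2 : ω f₂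
    · rfl
    · exact absurd (conn_of_openAdj ⟨f₂, h2, hf₂⟩) h.2.2

omit [Fintype E] [DecidableEq E] in
/-- On `PD` a connection between two vertices other than `a₃` is a star-closed connection. -/
lemma PD_inter_connEvent (hf₁ : ends f₁ = s(a₃, a₁)) (hf₂ : ends f₂ = s(a₃, a₂))
    (hf₃ : ends f₃ = s(a₃, o)) (hstar : ∀ e, a₃ ∈ ends e → e = f₁ ∨ e = f₂ ∨ e = f₃)
    (h31 : a₃ ≠ a₁) (h32 : a₃ ≠ a₂) (h3o : a₃ ≠ o) {x y : V} (hx : x ≠ a₃) (hy : y ≠ a₃) :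
    PDEvent ends a₁ a₂ a₃ ∩ connEvent ends x y =
      PDEvent ends a₁ a₂ a₃ ∩ viaStar ends a₃ (connEvent ends x y) := by
  ext ω
  simp only [Set.mem_inter_iff, viaStar, Set.mem_setOf_eq, mem_connEvent]
  constructor
  · rintro ⟨hPD, hc⟩
    obtain ⟨h1, h2⟩ := root_coins_closed_of_mem_PD ends hf₁ hf₂ hPD
    refine ⟨hPD, ?_⟩
    rw [conn_iff_single hf₁ hf₂ hf₃ hstar h31 h32 h3o (by simp [h1]) (by simp [h1]) (by simp [h2])
      hx hy] at hc
    exact hc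
  · rintro ⟨hPD, hc⟩
    obtain ⟨h1, h2⟩ := root_coins_closed_of_mem_PD ends hf₁ hf₂ hPD
    refine ⟨hPD, ?_⟩
    rw [conn_iff_single hf₁ hf₂ hf₃ hstar h31 h32 h3o (by simp [h1]) (by simp [h1]) (by simp [h2])
      hx hy]
    exact hc

omit [LinearOrder R] [IsStrictOrderedRing R] in
/-- **`D = P(PD)`** `= ᾱβ̄[r̄ Z₁ + r P₀(Q, o ∉ U)]`. -/
theorem prob_PD_star (hf₁ : ends f₁ = s(a₃, a₁)) (hf₂ : ends f₂ = s(a₃, a₂))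
    (hf₃ : ends f₃ = s(a₃, o)) (hstar : ∀ e, a₃ ∈ ends e → e = f₁ ∨ e = f₂ ∨ e = f₃)
    (h31 : a₃ ≠ a₁) (h32 : a₃ ≠ a₂) (h3o : a₃ ≠ o) (h12 : f₁ ≠ f₂) (h13 : f₁ ≠ f₃) (h23 : f₂ ≠ f₃) :
    prob p (PDEvent ends a₁ a₂ a₃) =
      (1 - p f₁) * (1 - p f₂) *
        ((1 - p f₃) * prob (pOut p ends a₃) (avoidAll ends a₂ {a₁}) +
          p f₃ * prob (pOut p ends a₃)
            (avoidAll ends a₂ {a₁} ∩ (connEvent ends o a₁)ᶜ ∩ (connEvent ends o a₂)ᶜ)) := by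
  have h := prob_PD_inter_star p ends hf₁ hf₂ hf₃ hstar h31 h32 h3o h12 h13 h23 Set.univ
  have e1 : viaStar ends a₃ (Set.univ : Set (Config E)) = Set.univ := by ext; simp [viaStar]
  rw [e1, Set.inter_univ, Set.inter_univ, Set.inter_univ] at h
  exact h

omit [LinearOrder R] [IsStrictOrderedRing R] in
/-- **`P(PD, x ↔ y)`** for `x, y ≠ a₃`: `ᾱβ̄[r̄ P₀(Q, x ↔ y) + r P₀(Q, o ∉ U, x ↔ y)]`. -/
theorem prob_PD_inter_conn_star (hf₁ : ends f₁ = s(a₃, a₁)) (hf₂ : ends f₂ = s(a₃, a₂))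
    (hf₃ : ends f₃ = s(a₃, o)) (hstar : ∀ e, a₃ ∈ ends e → e = f₁ ∨ e = f₂ ∨ e = f₃)
    (h31 : a₃ ≠ a₁) (h32 : a₃ ≠ a₂) (h3o : a₃ ≠ o) (h12 : f₁ ≠ f₂) (h13 : f₁ ≠ f₃) (h23 : f₂ ≠ f₃)
    {x y : V} (hx : x ≠ a₃) (hy : y ≠ a₃) :
    prob p (PDEvent ends a₁ a₂ a₃ ∩ connEvent ends x y) =
      (1 - p f₁) * (1 - p f₂) *
        ((1 - p f₃) * prob (pOut p ends a₃) (avoidAll ends a₂ {a₁} ∩ connEvent ends x y) +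
          p f₃ * prob (pOut p ends a₃)
            (avoidAll ends a₂ {a₁} ∩ (connEvent ends o a₁)ᶜ ∩ (connEvent ends o a₂)ᶜ ∩
              connEvent ends x y)) := by
  rw [PD_inter_connEvent ends hf₁ hf₂ hf₃ hstar h31 h32 h3o hx hy]
  exact prob_PD_inter_star p ends hf₁ hf₂ hf₃ hstar h31 h32 h3o h12 h13 h23 _

end MassPD

end StarO

end Summit.Ventures.PercRepro2
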